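import Literature.Analysis.FluidPDE.SeisDissipationRateBoundProofs
import HarnessLib

/-!
# Negative knowledge for the crux `UniformRelaxationWitness` (stmt-AnomalousDissipation-2937), III-a:
# the windowed core of Seis' dissipation-rate bound

Refuter (cdisprove) helper (supports stmt-AnomalousDissipation-2937). `seis_core_window` is the tree's
`Literature.Analysis.FluidPDE.seis_core` (Seis 2022 §2.2, `p = q = r = 2`, `δ² = κ`) with its four
GLOBAL hypotheses — drift essentially bounded in energy on `(0,∞)`, linear strain budget for all `t > 0`,
weak solution on every `[0,T)`, decay for a.e. `t > 0` — replaced by their restrictions to the dissipation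
horizon `(0, T)`, `T = (N+1)/D + 2`, which is all the printed proof and the tree's proof ever use (proof
body verbatim). Consumed by `SeisWindow.lean` (`seis_rmk1_window`, the windowed Remark 1, and the
sharpened floor `relaxingFamily_false_without_superlinearWindowedStrain`).

## References

* C. Seis, Comm. Math. Phys. 399 (2023) 2071–2081 = arXiv:2003.08794, Thm. 2, Rmk. 1, §2.2. [`Seis2022`]
-/

noncomputable section

open MeasureTheory Set Filter Metric Function Topology
open scoped ENNReal NNReal Topology InnerProductSpace Convolution
open Literature.Analysis.FunctionSpaces Literature.Analysis.FunctionSpaces.Torus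
open Literature.Analysis.SingularIntegrals Literature.Analysis.SingularIntegrals.Torus
open Literature.Analysis.FluidPDE Literature.Analysis.FluidPDE.Torus

namespace Summit.AnomalousDissipation.AnomalousDissipation.Theorems.UniformRelaxationWitness.Negative

-- D-0017: single-problem summit ⇒ `Summit.AnomalousDissipation.AnomalousDissipation.…` by design.
set_option linter.dupNamespace false

variable {d : Type*} [Fintype d] [DecidableEq d]

/-! ## The windowed core (verbatim `seis_core` with restricted hypotheses) -/

set_option maxHeartbeats 800000 in
/-- **Windowed core of Seis 2022, Thm. 2 / Rmk. 1** (`p = q = r = 2`, `δ² = κ`, `0 < D`): the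
estimate of `Literature.Analysis.FluidPDE.seis_core` with every hypothesis on the drift, the weak
solution and the decay restricted to the dissipation horizon `(0, T)`, `T = (N+1)/D + 2` — which is
all the printed proof (and the tree's) ever uses. Proof: verbatim the tree's `seis_core` (Seis 2022
§2.2: Lemma 4 at `ρ₀ = θ₀ ⋆ k_δ`, the chain of slice increments over good times, the brutal estimate
at a good time `τ ∈ [N/D, N/D+1]`), with the four global hypotheses replaced by their restrictions.
[cite: Seis2022, proof of Thm 2, §2.2 (pp. 7–8)] -/
theorem seis_core_window {a B C₀ M Mv : ℝ} (ha : 0 < a) (hB : 0 ≤ B) (hC₀ : 0 < C₀) (hM : 0 ≤ M)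
    (hMv : 0 ≤ Mv) {κ D : ℝ} {u : ℝ → UnitAddTorus d → EuclideanSpace ℝ d} {θ₀ : UnitAddTorus d → ℝ}
    {θ : ℝ → UnitAddTorus d → ℝ} (hD : 0 < D) {δ : ℝ} (hδ : 0 < δ)
    (hκδ : κ = δ ^ 2) (hδ4 : δ ≤ 1 / 4) (hδa : δ ≤ a / (2 * seisMod d B)) (N : ℕ)
    (hu2 : ∀ᵐ t ∂((volume : Measure ℝ).restrict (Ioo 0 (((N : ℝ) + 1) / D + 2))),
      ∫⁻ x, ‖u t x‖ₑ ^ 2 ≤ ENNReal.ofReal Mv)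
    (hgrad : ∫⁻ τ in Ioo 0 (((N : ℝ) + 1) / D + 2), eGradNormSq (u τ) ^ (1 / 2 : ℝ) ≤
      ENNReal.ofReal (M * (1 + (((N : ℝ) + 1) / D + 2))))
    (hθ₀ : IsSmooth θ₀) (hθ₀0 : ∫ x, θ₀ x = 0) (ha' : a ≤ ∫ x, |θ₀ x|)
    (hB' : ∫ x, ‖Torus.gradient θ₀ x‖ ≤ B)
    (hsol : Torus.IsWeakScalarTransportOn (((N : ℝ) + 1) / D + 2) κ u θ₀ θ)
    (hdecay : ∀ᵐ t ∂((volume : Measure ℝ).restrict (Ioo 0 (((N : ℝ) + 1) / D + 2))),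
      Torus.scalarL2Sq (θ t) ≤ (C₀ * Real.exp (-(D * t))) ^ 2) :
    a / 16 * Real.log (1 + min (a / 2 / seisMod d B) 1 / (lemma4Const d * δ)) -
        Real.log (1 + 1 / (2 * δ)) * (C₀ * Real.exp (-(N : ℝ))) ≤
      seisE2 d C₀ M * (1 + (((N : ℝ) + 1) / D + 2)) + 1 := by
  classical
  -- the kernel and the reference density
  have hk : IsSmooth (kernel (d := d) δ) := isSmooth_kernel hδ hδ4
  have hkc : Continuous (kernel (d := d) δ) := continuous_kernel hδ hδ4
  have hki : Integrable (kernel (d := d) δ) volume := hkc.integrable_unitAddTorus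
  have hθ₀i : Integrable θ₀ volume := hθ₀.integrable
  have hg : 0 < seisMod d B := seisMod_pos d hB
  set n : ℝ := (Fintype.card d : ℝ) with hn
  set CT := seisCT d with hCT
  set c₂ := seisC2 d with hc₂
  set E₂ := seisE2 d C₀ M with hE₂
  have hCT0 : 0 ≤ CT := seisCT_nonneg d
  have hc₂0 : 0 ≤ c₂ := seisC2_nonneg d
  set L₀ := Real.log (1 + 1 / (2 * δ)) with hL₀
  have hL₀0 : 0 ≤ L₀ := log_one_add_inv_two_mul_nonneg hδ
  -- mean zero and norms of mollifications
  have hmean_conv : ∀ {f : UnitAddTorus d → ℝ}, Integrable f volume → ∫ x, f x = 0 →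
      ∫ x, (f ⋆ kernel δ) x = 0 := fun {f} hf hf0 => by
    rw [integral_convolution (L := ContinuousLinearMap.lsmul ℝ ℝ) hf hki]
    simp [hf0]
  set ρ₀ : UnitAddTorus d → ℝ := θ₀ ⋆ kernel δ with hρ₀
  have hρ₀c : Continuous ρ₀ := continuous_convolution hθ₀i hkc
  have hρ₀i : Integrable ρ₀ volume := hρ₀c.integrable_unitAddTorus
  have hρ₀0 : ∫ x, ρ₀ x = 0 := hmean_conv hθ₀i hθ₀0
  -- time horizon
  set T : ℝ := (((N : ℝ) + 1) / D + 2) with hT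
  have hNDpos : 0 ≤ ((N : ℝ) + 1) / D := by positivity
  have hT1 : 1 ≤ T := by linarith
  have hT0 : 0 < T := by linarith
  have hinvD : 0 ≤ (1 : ℝ) / D := by positivity
  have hND : (N : ℝ) / D + 1 ≤ T := by
    have e : T = (N : ℝ) / D + 1 / D + 2 := by rw [hT, add_div]
    rw [e]; linarith
  have hsolT := hsol
  -- the enstrophy rate `G`
  set Ge : ℝ → ℝ≥0∞ := fun t => eGradNormSq (u t) ^ (1 / 2 : ℝ) with hGe
  have hGem : AEMeasurable Ge ((volume : Measure ℝ).restrict (Ioo 0 T)) :=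
    (aemeasurable_eGradNormSq_slice hsolT.aestronglyMeasurable_uncurry_velocity).pow_const _
  have hGfin : ∫⁻ t in Ioo 0 T, Ge t ≠ ∞ := (lt_of_le_of_lt hgrad ENNReal.ofReal_lt_top).ne
  set G : ℝ → ℝ := fun t => (Ge t).toReal with hG
  have hGi : IntegrableOn G (Ioo 0 T) := integrable_toReal_of_lintegral_ne_top hGem hGfin
  have hG0 : ∀ t, 0 ≤ G t := fun t => ENNReal.toReal_nonneg
  have hGint : ∫ t in Ioo 0 T, G t ≤ M * (1 + T) := by
    rw [hG, integral_toReal hGem (ae_lt_top' hGem hGfin)]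
    exact ENNReal.toReal_le_of_le_ofReal (by positivity) hgrad
  have hGsqrt : ∀ t, Real.sqrt (eGradNormSq (u t)).toReal = G t := fun t => sqrt_toReal_eq _
  -- the flux bound
  obtain ⟨bound, hbi, hbd⟩ := hsolT.exists_flux_bound₁ hk
  have hbd' : ∀ᵐ σ ∂((volume : Measure ℝ).restrict (Ioo 0 T)), ∀ x,
      ‖sliceFlux δ κ (θ σ) (u σ) x‖ ≤ bound σ := hbd
  have hflmT : AEStronglyMeasurable (uncurry fun σ x => sliceFlux δ κ (θ σ) (u σ) x)
      (((volume : Measure ℝ).restrict (Ioo 0 T)).prod volume) := hsolT.aestronglyMeasurable_uncurry_flux₁ hk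
  have hflxi : ∀ x, IntegrableOn (fun σ => sliceFlux δ κ (θ σ) (u σ) x) (Ioo 0 T) := fun x =>
    (hsolT.integrable_mul_flux hk x).integral_prod_left
  -- the good set
  set S : Set ℝ := {t | t ∈ Ioo 0 T ∧
    (∀ x, (θ t ⋆ kernel δ) x = ρ₀ x + ∫ σ in Ioc 0 t, sliceFlux δ κ (θ σ) (u σ) x) ∧
    ∫ x, θ t x = 0 ∧ MemLp (θ t) 2 volume ∧ Integrable (θ t) volume ∧ AEStronglyMeasurable (u t) volume ∧
    Integrable (fun y => ‖u t y‖ * θ t y) volume ∧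
    Torus.scalarL2Sq (θ t) ≤ (C₀ * Real.exp (-(D * t))) ^ 2 ∧
    (∫⁻ x, ‖u t x‖ₑ ^ 2 ≤ ENNReal.ofReal Mv) ∧ Ge t < ∞} with hS
  have hSae : ∀ᵐ t ∂((volume : Measure ℝ).restrict (Ioo 0 T)), t ∈ S := by
    filter_upwards [ae_restrict_mem measurableSet_Ioo, ae_seis_good hsolT hθ₀i hθ₀0 hδ hδ4,
      hdecay, hu2, ae_lt_top' hGem hGfin]
      with t ht hgood hdec hu hG
    exact ⟨ht, hgood.1, hgood.2.1, hgood.2.2.1, hgood.2.2.2.1, hgood.2.2.2.2.1, hgood.2.2.2.2.2, hdec, hu, hG⟩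
  -- facts at good times
  have hS_sq : ∀ {t}, t ∈ S → Real.sqrt (∫ x, θ t x ^ 2) ≤ C₀ := fun {t} ht => by
    have h1 : Real.sqrt (∫ x, θ t x ^ 2) ≤ C₀ * Real.exp (-(D * t)) := by
      rw [← Real.sqrt_sq (by positivity : 0 ≤ C₀ * Real.exp (-(D * t)))]
      exact Real.sqrt_le_sqrt ht.2.2.2.2.2.2.2.1
    refine h1.trans (mul_le_of_le_one_right hC₀.le ?_)
    exact Real.exp_le_one_iff.2 (by nlinarith [ht.1.1, hD])
  have hS_conv_c : ∀ {t}, t ∈ S → Continuous (θ t ⋆ kernel δ) := fun {t} ht => continuous_convolution ht.2.2.2.2.1 hkc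
  have hS_conv0 : ∀ {t}, t ∈ S → ∫ x, (θ t ⋆ kernel δ) x = 0 := fun {t} ht => hmean_conv ht.2.2.2.2.1 ht.2.2.1
  have hS_u2 : ∀ {t}, t ∈ S → MemLp (u t) 2 volume := fun {t} ht => memLp_two_of_lintegral_sq_le ht.2.2.2.2.2.1 ht.2.2.2.2.2.2.2.2.1
  have hS_eG : ∀ {t}, t ∈ S → eGradNormSq (u t) ≠ ∞ := fun {t} ht => by
    have h := ht.2.2.2.2.2.2.2.2.2
    simp only [hGe] at h
    exact (ENNReal.rpow_lt_top_iff_of_pos (by norm_num : (0 : ℝ) < 1 / 2)).1 h |>.ne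
  -- differences of mollified slices are flux integrals
  have hdiff : ∀ {s t : ℝ}, (s = 0 ∨ s ∈ S) → t ∈ S → s ≤ t → ∀ x,
      (θ t ⋆ kernel δ) x - (if s = 0 then ρ₀ x else (θ s ⋆ kernel δ) x) =
        ∫ σ in Ioc s t, sliceFlux δ κ (θ σ) (u σ) x := by
    intro s t hs ht hst x
    rcases hs with rfl | hs
    · simp only [if_true]
      rw [ht.2.1 x]; ring
    · have hs0 : s ≠ 0 := ne_of_gt hs.1.1
      rw [if_neg hs0, ht.2.1 x, hs.2.1 x]
      have hun : Ioc 0 t = Ioc 0 s ∪ Ioc s t := (Ioc_union_Ioc_eq_Ioc hs.1.1.le hst).symm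
      have hIt : IntegrableOn (fun σ => sliceFlux δ κ (θ σ) (u σ) x) (Ioc 0 t) :=
        (hflxi x).mono_set (Ioc_subset_Ioo_right ht.1.2)
      rw [hun, setIntegral_union (Ioc_disjoint_Ioc_of_le le_rfl) measurableSet_Ioc
        (hIt.mono_set (Ioc_subset_Ioc_right hst)) (hIt.mono_set (Ioc_subset_Ioc_left hs.1.1.le))]
      ring
  -- sup bound of flux integrals over short intervals: absolute continuity of `∫ bound`
  set Q : ℝ := δ⁻¹ * Real.sqrt Mv * T + L₀ + 1 with hQ
  have hQ0 : 0 < Q := by positivity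
  set η : ℝ := 1 / (2 * Q) with hη
  have hη0 : 0 < η := by positivity
  have hηQ : Q * η = 1 / 2 := by rw [hη]; field_simp
  obtain ⟨δ', hδ'0, hδ'⟩ := exists_pos_setLIntegral_lt_of_measure_lt
    (μ := (volume : Measure ℝ).restrict (Ioo 0 T)) (f := fun t => ‖bound t‖ₑ) hbi.2.ne
    (ENNReal.ofReal_pos.2 hη0).ne'
  set δ₁ : ℝ≥0∞ := min δ' 1 with hδ₁
  have hδ₁0 : δ₁ ≠ 0 := (lt_min hδ'0 zero_lt_one).ne'
  have hδ₁t : δ₁ ≠ ∞ := ne_top_of_le_ne_top ENNReal.one_ne_top (min_le_right _ _)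
  set h : ℝ := δ₁.toReal / 2 with hh
  have hh0 : 0 < h := by have := ENNReal.toReal_pos hδ₁0 hδ₁t; rw [hh]; linarith
  -- `∫_{(s,t]} bound ≤ η` for `(s,t] ⊆ (0,T)` of length `≤ h`
  have hshort : ∀ {s t : ℝ}, 0 ≤ s → s ≤ t → t < T → t - s ≤ h → ∫ σ in Ioc s t, bound σ ≤ η := by
    intro s t hs0 hst htT hts
    have hsub : Ioc s t ⊆ Ioo 0 T := fun σ hσ => ⟨hs0.trans_lt hσ.1, hσ.2.trans_lt htT⟩
    have hmeas : ((volume : Measure ℝ).restrict (Ioo 0 T)) (Ioc s t) < δ' := by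
      rw [Measure.restrict_apply measurableSet_Ioc, Set.inter_eq_self_of_subset_left hsub, Real.volume_Ioc]
      calc ENNReal.ofReal (t - s) ≤ ENNReal.ofReal h := ENNReal.ofReal_le_ofReal hts
        _ < δ₁ := by
            refine (ENNReal.ofReal_lt_iff_lt_toReal hh0.le hδ₁t).2 ?_
            rw [hh]; linarith [ENNReal.toReal_pos hδ₁0 hδ₁t]
        _ ≤ δ' := min_le_left _ _
    have hlt := hδ' (Ioc s t) hmeas
    rw [Measure.restrict_restrict_of_subset hsub] at hlt
    have hbi' : IntegrableOn bound (Ioc s t) := hbi.mono_set hsub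
    calc ∫ σ in Ioc s t, bound σ ≤ ∫ σ in Ioc s t, ‖bound σ‖ := integral_mono hbi' hbi'.norm fun σ => Real.le_norm_self _
      _ = (∫⁻ σ in Ioc s t, ‖bound σ‖ₑ).toReal := integral_norm_eq_lintegral_enorm hbi'.aestronglyMeasurable
      _ ≤ (ENNReal.ofReal η).toReal := ENNReal.toReal_mono ENNReal.ofReal_ne_top hlt.le
      _ = η := ENNReal.toReal_ofReal hη0.le
  -- flux integrals over short good intervals are `≤ η` pointwise
  have hflux_small : ∀ {s σ : ℝ}, 0 ≤ s → s ≤ σ → σ < T → σ - s ≤ h → ∀ x,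
      |∫ r in Ioc s σ, sliceFlux δ κ (θ r) (u r) x| ≤ η := by
    intro s σ hs0 hsσ hσT hσs x
    have hsub : Ioc s σ ⊆ Ioo 0 T := fun r hr => ⟨hs0.trans_lt hr.1, hr.2.trans_lt hσT⟩
    refine le_trans ?_ (hshort hs0 hsσ hσT hσs)
    rw [← Real.norm_eq_abs]
    exact norm_integral_le_of_norm_le (hbi.mono_set hsub)
      ((ae_restrict_of_ae_restrict_of_subset hsub hbd').mono fun r hr => hr x)
  -- a good time `τ ∈ [N/D, N/D+1)` and a good time `s₁ ≤ min h τ`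
  have hND0 : 0 ≤ (N : ℝ) / D := by positivity
  obtain ⟨τ, hτS, hτI⟩ := exists_mem_of_ae_mem hSae hND0 (by linarith : (N : ℝ) / D < (N : ℝ) / D + 1) hND
  have hτ0 : 0 < τ := hτS.1.1
  have hτT : τ < T := hτS.1.2
  obtain ⟨s₁, hs₁S, hs₁I⟩ := exists_mem_of_ae_mem hSae le_rfl (lt_min hh0 hτ0)
    ((min_le_right _ _).trans hτT.le)
  have hs₁0 : 0 < s₁ := hs₁S.1.1
  have hs₁h : s₁ ≤ h := (hs₁I.2.trans_le (min_le_left _ _)).le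
  have hs₁τ : s₁ < τ := hs₁I.2.trans_le (min_le_right _ _)
  -- the chain of good times from `s₁` to `τ`
  obtain ⟨J, p, hJ, hp0, hpJ, hmono, hpS, hgap⟩ := exists_chain_mem hSae hs₁S hs₁0 hτS hs₁τ hτT hh0
  set Φ : ℝ → ℝ := fun t => krLogDist δ (θ t ⋆ kernel δ) with hΦ
  set m : ℝ → ℝ := fun σ => C₀ * (CT + Real.sqrt n) * G σ + c₂ * C₀ with hm
  set c : ℝ := δ⁻¹ * η * Real.sqrt Mv with hc
  have hmono' : ∀ i j, i ≤ j → j ≤ J → p i ≤ p j := by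
    intro i j hij hjJ
    induction j with
    | zero => simp [Nat.le_zero.1 hij]
    | succ j ih =>
      rcases Nat.lt_or_ge i (j + 1) with hlt | hge
      · exact (ih (Nat.lt_succ_iff.1 hlt) (Nat.le_of_succ_le hjJ)).trans (hmono j (Nat.lt_of_succ_le hjJ)).le
      · rw [le_antisymm hij hge]
  have hpT : ∀ j, j ≤ J → p j < T := fun j hj => (hpS j hj).1.2
  have hp0' : ∀ j, j ≤ J → 0 < p j := fun j hj => (hpS j hj).1.1
  -- the increments
  have hinc : ∀ j, j < J → Φ (p j) - Φ (p (j + 1)) ≤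
      (∫ σ in Ioc (p j) (p (j + 1)), m σ) + c * (p (j + 1) - p j) := by
    intro j hj
    have hsS := hpS j hj.le
    have htS := hpS (j + 1) (Nat.succ_le_of_lt hj)
    have hst : p j ≤ p (j + 1) := (hmono j hj).le
    have hsub : Ioc (p j) (p (j + 1)) ⊆ Ioo 0 T := fun σ hσ => ⟨(hp0' j hj.le).trans hσ.1, hσ.2.trans_lt (hpT _ (Nat.succ_le_of_lt hj))⟩
    have hkey := krLogDist_sub_le_seis (d := d) hδ hδ4 hκδ (C₀ := C₀) (Mv := Mv) (S₀ := η) hMv hη0.le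
      ((hS_conv_c hsS).memLp_of_hasCompactSupport (HasCompactSupport.of_compactSpace _)) (hS_conv_c hsS)
      (hS_conv0 hsS) ((sqrt_integral_sq_convolution_kernel_le hsS.2.2.2.1 hδ hδ4).trans (hS_sq hsS))
      (hS_conv_c htS).integrable_unitAddTorus (hS_conv0 htS)
      (fun x => by simpa [ne_of_gt hsS.1.1] using hdiff (Or.inr hsS) htS hst x)
      (hflmT.mono_measure (Measure.prod_mono (Measure.restrict_mono hsub le_rfl) le_rfl))
      (ae_restrict_of_ae_restrict_of_subset hsub hbd') (hbi.mono_set hsub) ?_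
      ((hGi.mono_set hsub).congr (Eventually.of_forall fun σ => (hGsqrt σ).symm))
    · -- conclude from `hkey`
      have hmi : IntegrableOn m (Ioc (p j) (p (j + 1))) :=
        (((hGi.mono_set hsub).const_mul _).add (integrableOn_const measure_Ioc_lt_top.ne))
      have e : ∫ σ in Ioc (p j) (p (j + 1)), (C₀ * (seisCT d + Real.sqrt (Fintype.card d)) *
          Real.sqrt (eGradNormSq (u σ)).toReal + (seisC2 d * C₀ + δ⁻¹ * η * Real.sqrt Mv)) =
          (∫ σ in Ioc (p j) (p (j + 1)), m σ) + c * (p (j + 1) - p j) := by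
        have e1 : ∀ σ, C₀ * (seisCT d + Real.sqrt (Fintype.card d)) * Real.sqrt (eGradNormSq (u σ)).toReal +
            (seisC2 d * C₀ + δ⁻¹ * η * Real.sqrt Mv) = m σ + c := fun σ => by
          simp only [hm, hc, hGsqrt, hCT, hc₂, hn]; ring
        simp_rw [e1]
        rw [integral_add hmi (integrableOn_const measure_Ioc_lt_top.ne), setIntegral_const,
          Real.volume_real_Ioc_of_le hst, smul_eq_mul, mul_comm]
      rw [e] at hkey
      exact hkey
    · -- the slice facts on `(p j, p (j+1)]`
      filter_upwards [ae_restrict_mem measurableSet_Ioc,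
        ae_restrict_of_ae_restrict_of_subset hsub hSae] with σ hσI hσS
      refine ⟨hσS.2.2.2.1, hS_sq hσS, hS_u2 hσS, hσS.2.2.2.2.2.2.2.2.1, hS_eG hσS, fun x => ?_⟩
      have e := hdiff (Or.inr hsS) hσS hσI.1.le x
      simp only [ne_of_gt hsS.1.1, if_false] at e
      rw [e]
      exact hflux_small (hp0' j hj.le).le hσI.1.le hσS.1.2 (by linarith [hσI.2, hgap j hj]) x
  -- the chain estimate `Φ s₁ - Φ τ ≤ ∫_{(s₁,τ]} m + c (τ - s₁)`
  have hsub1 : Ioc s₁ τ ⊆ Ioo 0 T := fun σ hσ => ⟨hs₁0.trans hσ.1, hσ.2.trans_lt hτT⟩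
  have hmiT : IntegrableOn m (Ioc (p 0) (p J)) := by
    rw [hp0, hpJ]
    exact ((hGi.mono_set hsub1).const_mul _).add (integrableOn_const measure_Ioc_lt_top.ne)
  have hchain := sub_le_integral_add_of_chain (fun j hj => (hmono j hj).le) hmiT hinc
  rw [hp0, hpJ] at hchain
  -- `∫_{(s₁,τ]} m ≤ C₀ (C_T + √d) M (1+T) + d c₂ C₀ T`
  have hIm : ∫ σ in Ioc s₁ τ, m σ ≤ C₀ * (CT + Real.sqrt n) * (M * (1 + T)) + c₂ * C₀ * T := by
    have hGI : ∫ σ in Ioc s₁ τ, G σ ≤ M * (1 + T) :=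
      (setIntegral_mono_set hGi (Eventually.of_forall hG0) (Eventually.of_forall hsub1)).trans hGint
    simp only [hm]
    rw [integral_add ((hGi.mono_set hsub1).const_mul _) (integrableOn_const measure_Ioc_lt_top.ne),
      integral_const_mul, setIntegral_const, Real.volume_real_Ioc_of_le hs₁τ.le, smul_eq_mul]
    have h1 : C₀ * (CT + Real.sqrt n) * ∫ σ in Ioc s₁ τ, G σ ≤ C₀ * (CT + Real.sqrt n) * (M * (1 + T)) :=
      mul_le_mul_of_nonneg_left hGI (by positivity)
    have h2 : (τ - s₁) * (c₂ * C₀) ≤ T * (c₂ * C₀) := mul_le_mul_of_nonneg_right (by linarith) (by positivity)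
    linarith
  -- the two small errors
  have hQ1 : δ⁻¹ * Real.sqrt Mv * T ≤ Q := by rw [hQ]; linarith
  have hQ2 : L₀ ≤ Q := by
    have h0 : 0 ≤ δ⁻¹ * Real.sqrt Mv * T := by positivity
    rw [hQ]; linarith
  have hcT : c * (τ - s₁) ≤ 1 / 2 := by
    calc c * (τ - s₁) ≤ c * T := mul_le_mul_of_nonneg_left (by linarith) (by positivity)
      _ = η * (δ⁻¹ * Real.sqrt Mv * T) := by rw [hc]; ring
      _ ≤ η * Q := mul_le_mul_of_nonneg_left hQ1 hη0.le
      _ = 1 / 2 := by rw [mul_comm, hηQ]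
  have hstart : krLogDist δ ρ₀ - Φ s₁ ≤ 1 / 2 := by
    have hε : ∀ x, |ρ₀ x - (θ s₁ ⋆ kernel δ) x| ≤ η := fun x => by
      have e := hdiff (Or.inl rfl) hs₁S hs₁0.le x
      simp only [if_true] at e
      rw [abs_sub_comm, e]
      exact hflux_small le_rfl hs₁0.le hs₁S.1.2 (by linarith) x
    have h1 := krLogDist_le_krLogDist_add_of_abs_sub_le hδ hρ₀i hρ₀0
      (hS_conv_c hs₁S).integrable_unitAddTorus (hS_conv0 hs₁S) hε
    have h2 : L₀ * η ≤ 1 / 2 := by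
      calc L₀ * η ≤ Q * η := mul_le_mul_of_nonneg_right hQ2 hη0.le
        _ = 1 / 2 := hηQ
    show krLogDist δ ρ₀ - krLogDist δ (θ s₁ ⋆ kernel δ) ≤ 1 / 2
    linarith
  have hE : C₀ * (CT + Real.sqrt n) * (M * (1 + T)) + c₂ * C₀ * T ≤ E₂ * (1 + T) := by
    have e : E₂ * (1 + T) = C₀ * (CT + Real.sqrt n) * (M * (1 + T)) + c₂ * C₀ * (1 + T) := by
      rw [hE₂, seisE2, ← hCT, ← hn, ← hc₂]; ring
    rw [e]
    have h0 : 0 ≤ c₂ * C₀ := by positivity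
    have h1 : c₂ * C₀ * T ≤ c₂ * C₀ * (1 + T) := mul_le_mul_of_nonneg_left (by linarith) h0
    linarith
  have hupper_chain : krLogDist δ ρ₀ - Φ τ ≤ E₂ * (1 + T) + 1 := by linarith [hstart, hchain, hIm, hcT, hE]
  -- lower endpoint: Lemma 4 at `ρ₀ = θ₀ ⋆ k_δ`
  have hgB : Real.sqrt (Fintype.card d) * (∫ z, ‖Torus.gradient θ₀ z‖) ≤ seisMod d B := by
    rw [seisMod]
    have h1 : Real.sqrt (Fintype.card d) * (∫ z, ‖Torus.gradient θ₀ z‖) ≤ Real.sqrt (Fintype.card d) * B :=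
      mul_le_mul_of_nonneg_left hB' (Real.sqrt_nonneg _)
    linarith
  have hmodθ₀ : ∀ y, eLpNorm (fun x => θ₀ (x - y) - θ₀ x) 1 volume ≤ ENNReal.ofReal (seisMod d B * ‖y‖) :=
    fun y => eLpNorm_translate_sub_le_integral_norm_gradient (hθ₀.isContDiff (by simp)) hgB y
  have hmodρ₀ : ∀ y, eLpNorm (fun x => ρ₀ (x - y) - ρ₀ x) 1 volume ≤ ENNReal.ofReal (seisMod d B * ‖y‖) :=
    fun y => (eLpNorm_sub_translate_convolution_kernel_le hθ₀i hδ hδ4 y).trans (hmodθ₀ y)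
  have hm₀ : a / 2 ≤ ∫ x, |ρ₀ x| := by
    have h1 : ∫ x, |ρ₀ x - θ₀ x| ≤ seisMod d B * δ :=
      integral_abs_convolution_kernel_sub_self_le hθ₀i hg.le hmodθ₀ hδ hδ4
    have hi2 : Integrable (fun x => |ρ₀ x - θ₀ x|) volume := (hρ₀i.sub hθ₀i).abs
    have h2 : ∫ x, |θ₀ x| ≤ (∫ x, |ρ₀ x|) + ∫ x, |ρ₀ x - θ₀ x| := by
      rw [← integral_add hρ₀i.abs hi2]
      refine integral_mono hθ₀i.abs (hρ₀i.abs.add hi2) fun x => ?_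
      have := abs_sub_abs_le_abs_sub (θ₀ x) (ρ₀ x)
      rw [abs_sub_comm] at this
      linarith
    have h3 : seisMod d B * δ ≤ a / 2 := by
      rw [le_div_iff₀ (by positivity)] at hδa
      linarith
    linarith
  have hlower : a / 16 * Real.log (1 + min (a / 2 / seisMod d B) 1 / (lemma4Const d * δ)) ≤ krLogDist δ ρ₀ := by
    have hL4 := krLogDist_ge_of_translation hδ hρ₀i hρ₀c.measurable hρ₀0 hg hmodρ₀
    set m₀ : ℝ := ∫ x, |ρ₀ x| with hm₀def
    -- monotonicity in `m₀ ≥ a/2`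
    have hx : min (a / 2 / seisMod d B) 1 ≤ min (m₀ / seisMod d B) 1 :=
      min_le_min (div_le_div_of_nonneg_right hm₀ hg.le) le_rfl
    have hx0 : 0 ≤ min (a / 2 / seisMod d B) 1 := le_min (by positivity) zero_le_one
    have hlog0 : 0 ≤ Real.log (1 + min (a / 2 / seisMod d B) 1 / (lemma4Const d * δ)) :=
      Real.log_nonneg (by
        have : 0 ≤ min (a / 2 / seisMod d B) 1 / (lemma4Const d * δ) :=
          div_nonneg hx0 (mul_nonneg (lemma4Const_nonneg d) hδ.le)
        linarith)
    have hlogmono : Real.log (1 + min (a / 2 / seisMod d B) 1 / (lemma4Const d * δ)) ≤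
        Real.log (1 + min (m₀ / seisMod d B) 1 / (lemma4Const d * δ)) := by
      refine Real.log_le_log (by
        have : 0 ≤ min (a / 2 / seisMod d B) 1 / (lemma4Const d * δ) :=
          div_nonneg hx0 (mul_nonneg (lemma4Const_nonneg d) hδ.le)
        linarith) ?_
      linarith [div_le_div_of_nonneg_right hx (mul_nonneg (lemma4Const_nonneg d) hδ.le)]
    calc a / 16 * Real.log (1 + min (a / 2 / seisMod d B) 1 / (lemma4Const d * δ))
        ≤ m₀ / 8 * Real.log (1 + min (m₀ / seisMod d B) 1 / (lemma4Const d * δ)) :=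
          mul_le_mul (by linarith) hlogmono hlog0 (by linarith)
      _ ≤ krLogDist δ ρ₀ := hL4
  -- upper endpoint: brutal estimate at `τ`
  have hupper : Φ τ ≤ L₀ * (C₀ * Real.exp (-(N : ℝ))) := by
    have h1 : Φ τ ≤ L₀ * ∫ x, |(θ τ ⋆ kernel δ) x| :=
      krLogDist_le hδ (hS_conv_c hτS).integrable_unitAddTorus (hS_conv0 hτS)
    have h2 : ∫ x, |(θ τ ⋆ kernel δ) x| ≤ C₀ * Real.exp (-(D * τ)) := by
      refine (integral_abs_convolution_kernel_le hτS.2.2.2.2.1 hδ hδ4).trans ?_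
      refine (integral_abs_le_sqrt_integral_sq hτS.2.2.2.1).trans ?_
      rw [← Real.sqrt_sq (by positivity : 0 ≤ C₀ * Real.exp (-(D * τ)))]
      exact Real.sqrt_le_sqrt hτS.2.2.2.2.2.2.2.1
    have h3 : Real.exp (-(D * τ)) ≤ Real.exp (-(N : ℝ)) := by
      refine Real.exp_le_exp.2 (neg_le_neg ?_)
      have := hτI.1.le
      rw [div_le_iff₀ hD] at this
      linarith
    have h4 : C₀ * Real.exp (-(D * τ)) ≤ C₀ * Real.exp (-(N : ℝ)) := mul_le_mul_of_nonneg_left h3 hC₀.le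
    calc Φ τ ≤ L₀ * ∫ x, |(θ τ ⋆ kernel δ) x| := h1
      _ ≤ L₀ * (C₀ * Real.exp (-(N : ℝ))) := mul_le_mul_of_nonneg_left (h2.trans h4) hL₀0
  linarith

end Summit.AnomalousDissipation.AnomalousDissipation.Theorems.UniformRelaxationWitness.Negative

end
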